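import Mathlib
import Literature.Probability.LatticeModels.EffectiveResistance
import Literature.Probability.LatticeModels.DomainDiscretisation
import Literature.Probability.RandomPlanarGeometry.PlanarDomains
import Literature.Analysis.Complex.ExtremalLength
import HarnessLib

/-!
# Discrete conductance between arcs converges to the reciprocal extremal distance

Topic `Literature/Probability/LatticeModels` (electrical networks on the mesh discretisation
`discreteDomainGraph Ω δ` of a planar domain, `DomainDiscretisation.lean`, `EffectiveResistance.lean`).
One NAMED FACT, moved here byte-identical by the librarian (2026-08-16, sweep g21) from the
gate-parked module `Literature/Uncategorized/G02ModulusConvergence.lean` (accept-time relocation of a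
`[cite]`d proposition written inline in
`Summits/CriticalPhenomena/CardyFormulaZ2/Theorems/CardyUSTContinuationKirchhoffExtremalLengthDefs.lean`,
human ruling 2026-08-15), under a name that says what it states; the old name
`Literature.Uncategorized.G02ModulusConvergence` is kept there as a deprecated reducible alias.

* `Literature.Probability.LatticeModels.effectiveConductance_discreteArcs_tendsto_inv_extremalDistance` —
  for every conformal rectangle `(Ω; a, b, c, d)`, the unit-conductance effective conductance between
  the discretised arcs `(ab)_δ`, `(cd)_δ` of `Ω_δ` tends, as `δ → 0⁺`, to `d_Ω((ab),(cd))⁻¹`, the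
  reciprocal of Ahlfors' extremal distance between the arcs: the `meshDomain`/`discreteArc`
  rendering of Georgakopoulos–Panagiotis, *Convergence of square tilings to the Riemann map*
  (arXiv:1910.06886), Corollary 4.15 (convergence of discrete to continuum extremal length / modulus
  for Jordan domains approximated by subgraphs of `δℤ²`). No module states a discharge; the fact
  is the hypothesis of `kirchhoffExtremalLength_of_conductance_tendsto'` on the summit side.

## References
* [GeorgakopoulosPanagiotis2019] A. Georgakopoulos, C. Panagiotis, *Convergence of square tilings to
  the Riemann map*, arXiv:1910.06886 (2019), Cor. 4.15.
-/

namespace Literature.Probability.LatticeModels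

open Filter Topology
open Literature.Probability.RandomPlanarGeometry

/-- **Convergence of the discrete conductance between the arcs to the reciprocal extremal
distance (G02 discretisation).** For every conformal rectangle `R = (Ω; a, b, c, d)`, the
unit-conductance effective conductance between the discrete arcs of `(ab)` and `(cd)` in
`Ω_δ = discreteDomainGraph Ω δ` tends, as the mesh `δ → 0⁺`, to `d_Ω((ab), (cd))⁻¹`, the
reciprocal of Ahlfors' extremal distance between the arcs (both sides read in `ℝ` through
`ENNReal.toReal`). The `meshDomain`/`discreteArc` analogue of [GP19] Cor. 4.15; the hypothesis of
`kirchhoffExtremalLength_of_conductance_tendsto'`. (Body byte-identical to the parked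
`Literature.Uncategorized.G02ModulusConvergence`, librarian move 2026-08-16.)
[cite: GeorgakopoulosPanagiotis2019, Corollary 4.15] -/
def effectiveConductance_discreteArcs_tendsto_inv_extremalDistance : Prop :=
  ∀ R : ConformalRectangle, Tendsto (fun δ : ℝ =>
      (effectiveConductance (discreteDomainGraph R.carrier δ) 1
        (discreteArc R.carrier δ (R.arc 0)) (discreteArc R.carrier δ (R.arc 2))).toReal)
    (𝓝[>] 0)
    (𝓝 ((Literature.Analysis.Complex.extremalDistance R.carrier (R.arc 0) (R.arc 2))⁻¹).toReal)

end Literature.Probability.LatticeModels
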